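import Mathlib
import HarnessLib
import Summits.RiemannHypothesis.RiemannHypothesis.Theorems.DBNCauchyFourier

/-!
# RiemannHypothesis / NbSectionTwoDyadic — the Nyman–Beurling GRAM PAIRING on the critical line

Support for the Assembly of route `NbSectionTwoDyadic` (item stmt-RiemannHypothesis-22784) and for
the NB-Gram toolkit shared with route `NbGhostOfThePole`:

* `integral_cexp_mul_I_div` — the complex Poisson-kernel transform
  `∫ e^{itx} dt/(1/4+t²) = 2π e^{−|x|/2}`, read off the tree's Fourier transform of the Cauchy
  kernel (`Theorems/DBNCauchyFourier.lean`, `fourier_cauchyC` with `a = 1/2` at `w = −x/(2π)`);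
* `integral_cpow_mul_conj_cpow_div` — the PAIRING KERNEL of the critical-line measure
  `∫ m^{-(1/2+it)} · conj(n^{-(1/2+it)}) dt/(1/4+t²) = 2π / max(m,n)` (`m, n ≥ 1`);
* `integral_norm_sq_sum_cpow_div` — the GRAM EXPANSION of a finite Dirichlet polynomial
  `∫ ‖Σ_m c_m m^{-(1/2+it)}‖² dt/(1/4+t²) = Σ_{m,n} Re(c_m c̄_n) · 2π/max(m,n)`, with the
  integrability of the integrand (`integrable_norm_sq_sum_cpow_div`).

Route-independent (imports no `Theses` file). Elementary calculus (Mellin–Plancherel picture: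
`n^{-s}/s ↔ χ_(0,1/n]`, Gram `1/max(m,n)`); RH-free. No summit is proved by this file; nothing here
bears on the truth of RH.
-/

noncomputable section

-- D-0017: `Summit.<S>.<S>.…` is the designed namespace of a single-problem summit.
set_option linter.dupNamespace false

open scoped Real ComplexConjugate
open MeasureTheory Complex Filter Finset

namespace Summit.RiemannHypothesis.RiemannHypothesis.Theorems.NbSectionTwo

open Summit.RiemannHypothesis.RiemannHypothesis.Theorems.DbnTheory

/-- The modulated Poisson kernel `t ↦ e^{itx} / (1/4 + t²)` is integrable. [folklore] -/
theorem integrable_cexp_mul_I_div (x : ℝ) :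
    Integrable fun t : ℝ => Complex.exp (↑(t * x) * I) / ((1 / 4 + t ^ 2 : ℝ) : ℂ) := by
  have h : Integrable fun t : ℝ =>
      Complex.exp (↑(t * x) * I) * ((((1 / 2 : ℝ) / (t ^ 2 + (1 / 2 : ℝ) ^ 2)) : ℝ) : ℂ) := by
    refine (integrable_cauchyC (1 / 2 : ℝ) (by norm_num)).bdd_mul (c := 1)
      (by fun_prop : Continuous fun t : ℝ => Complex.exp (↑(t * x) * I)).aestronglyMeasurable
      (Eventually.of_forall fun t => ?_)
    rw [Complex.norm_exp_ofReal_mul_I]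
  refine (h.const_mul 2).congr (Eventually.of_forall fun t => ?_)
  have hw : ((1 / 4 + t ^ 2 : ℝ) : ℂ) ≠ 0 := by
    exact_mod_cast (by positivity : (1 / 4 + t ^ 2 : ℝ) ≠ 0)
  have hv : ((t ^ 2 + (1 / 2 : ℝ) ^ 2 : ℝ) : ℂ) ≠ 0 := by
    exact_mod_cast (by positivity : (t ^ 2 + (1 / 2 : ℝ) ^ 2 : ℝ) ≠ 0)
  dsimp only
  push_cast
  field_simp
  ring

/-- **The complex Poisson-kernel transform of the critical-line measure**:
`∫ e^{itx} dt/(1/4 + t²) = 2π e^{−|x|/2}` for every real `x` — the Fourier transform of the Cauchy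
kernel `𝓕[a/(s²+a²)](w) = π e^{−2πa|w|}` (`fourier_cauchyC`) at `a = 1/2`, `w = −x/(2π)`.
[folklore] -/
theorem integral_cexp_mul_I_div (x : ℝ) :
    ∫ t : ℝ, Complex.exp (↑(t * x) * I) / ((1 / 4 + t ^ 2 : ℝ) : ℂ)
      = ((2 * π * Real.exp (-|x| / 2) : ℝ) : ℂ) := by
  have h := congrFun (fourier_cauchyC (1 / 2 : ℝ) (by norm_num)) (-x / (2 * π))
  rw [Real.fourier_real_eq_integral_exp_smul] at h
  have hπ : π ≠ 0 := Real.pi_pos.ne'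
  have harg : ∀ v : ℝ, -2 * π * v * (-x / (2 * π)) = v * x := by
    intro v
    field_simp
  have habs : -(2 * π * (1 / 2 : ℝ) * |-x / (2 * π)|) = -|x| / 2 := by
    rw [abs_div, abs_neg, abs_of_pos (by positivity : (0 : ℝ) < 2 * π)]
    field_simp
  simp_rw [harg, smul_eq_mul] at h
  have hfun : (fun t : ℝ => Complex.exp (↑(t * x) * I) / ((1 / 4 + t ^ 2 : ℝ) : ℂ))
      = fun t : ℝ => (2 : ℂ) * (Complex.exp (↑(t * x) * I) *
          ((((1 / 2 : ℝ) / (t ^ 2 + (1 / 2 : ℝ) ^ 2)) : ℝ) : ℂ)) := by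
    funext t
    have hw : ((1 / 4 + t ^ 2 : ℝ) : ℂ) ≠ 0 := by
      exact_mod_cast (by positivity : (1 / 4 + t ^ 2 : ℝ) ≠ 0)
    have hv : ((t ^ 2 + (1 / 2 : ℝ) ^ 2 : ℝ) : ℂ) ≠ 0 := by
      exact_mod_cast (by positivity : (t ^ 2 + (1 / 2 : ℝ) ^ 2 : ℝ) ≠ 0)
    push_cast
    field_simp
    ring
  rw [hfun, integral_const_mul, h, habs]
  push_cast
  ring

/-- Polar form on the critical line: `n^{-(1/2+it)} = e^{-(log n)/2} · e^{-it log n}` (`n ≥ 1`).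
[folklore] -/
theorem natCast_cpow_neg_half_add (n : ℕ) (hn : n ≠ 0) (t : ℝ) :
    (n : ℂ) ^ (-(1 / 2 + t * I)) =
      ((Real.exp (-Real.log n / 2) : ℝ) : ℂ) * Complex.exp (((-(t * Real.log n) : ℝ) : ℂ) * I) := by
  have hn' : (n : ℂ) ≠ 0 := by exact_mod_cast hn
  rw [Complex.cpow_def_of_ne_zero hn', ← Complex.ofReal_natCast,
    ← Complex.ofReal_log (Nat.cast_nonneg n), Complex.ofReal_exp, ← Complex.exp_add]
  congr 1
  push_cast
  ring

/-- The product `m^{-s} · conj(n^{-s})` on the critical line `s = 1/2 + it`: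
`= e^{-(log m + log n)/2} · e^{it (log n − log m)}`. [folklore] -/
theorem cpow_mul_conj_cpow (m n : ℕ) (hm : m ≠ 0) (hn : n ≠ 0) (t : ℝ) :
    (m : ℂ) ^ (-(1 / 2 + t * I)) * conj ((n : ℂ) ^ (-(1 / 2 + t * I))) =
      ((Real.exp (-(Real.log m + Real.log n) / 2) : ℝ) : ℂ) *
        Complex.exp (((t * (Real.log n - Real.log m) : ℝ) : ℂ) * I) := by
  rw [natCast_cpow_neg_half_add m hm, natCast_cpow_neg_half_add n hn, map_mul, Complex.conj_ofReal,
    ← Complex.exp_conj, map_mul, Complex.conj_ofReal, Complex.conj_I]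
  simp only [Complex.ofReal_exp, ← Complex.exp_add]
  congr 1
  push_cast
  ring

/-- The scalar identity behind the pairing: `e^{-(log m + log n)/2} · 2π e^{-|log n − log m|/2}
= 2π / max(m,n)` (`m, n ≥ 1`). [folklore] -/
theorem exp_mul_two_pi_mul_exp_eq (m n : ℕ) (hm : m ≠ 0) (hn : n ≠ 0) :
    Real.exp (-(Real.log m + Real.log n) / 2) *
        (2 * π * Real.exp (-|Real.log n - Real.log m| / 2)) = 2 * π / ((max m n : ℕ) : ℝ) := by
  have hm' : (0 : ℝ) < m := by exact_mod_cast Nat.pos_of_ne_zero hm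
  have hn' : (0 : ℝ) < n := by exact_mod_cast Nat.pos_of_ne_zero hn
  have key : Real.exp (-(Real.log m + Real.log n) / 2) * Real.exp (-|Real.log n - Real.log m| / 2)
      = 1 / ((max m n : ℕ) : ℝ) := by
    rw [← Real.exp_add]
    rcases le_total m n with h | h
    · have hlog : Real.log m ≤ Real.log n := Real.log_le_log hm' (by exact_mod_cast h)
      rw [abs_of_nonneg (by linarith), max_eq_right h,
        show -(Real.log m + Real.log n) / 2 + -(Real.log n - Real.log m) / 2 = -Real.log n by ring,
        Real.exp_neg, Real.exp_log hn', one_div]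
    · have hlog : Real.log n ≤ Real.log m := Real.log_le_log hn' (by exact_mod_cast h)
      rw [abs_of_nonpos (by linarith), max_eq_left h,
        show -(Real.log m + Real.log n) / 2 + - -(Real.log n - Real.log m) / 2 = -Real.log m by ring,
        Real.exp_neg, Real.exp_log hm', one_div]
  calc Real.exp (-(Real.log m + Real.log n) / 2) * (2 * π * Real.exp (-|Real.log n - Real.log m| / 2))
      = 2 * π * (Real.exp (-(Real.log m + Real.log n) / 2) *
          Real.exp (-|Real.log n - Real.log m| / 2)) := by ring
    _ = 2 * π / ((max m n : ℕ) : ℝ) := by rw [key]; ring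

/-- The pairing integrand rewritten against the modulated Cauchy kernel. [folklore] -/
theorem pairing_integrand_eq (m n : ℕ) (hm : m ≠ 0) (hn : n ≠ 0) :
    (fun t : ℝ => (m : ℂ) ^ (-(1 / 2 + t * I)) * conj ((n : ℂ) ^ (-(1 / 2 + t * I))) /
        ((1 / 4 + t ^ 2 : ℝ) : ℂ))
      = fun t : ℝ => ((Real.exp (-(Real.log m + Real.log n) / 2) : ℝ) : ℂ) *
          (Complex.exp (↑(t * (Real.log n - Real.log m)) * I) / ((1 / 4 + t ^ 2 : ℝ) : ℂ)) := by
  funext t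
  rw [cpow_mul_conj_cpow m n hm hn t, mul_div_assoc]

/-- Each pairing integrand is integrable. [folklore] -/
theorem integrable_pairing (m n : ℕ) (hm : m ≠ 0) (hn : n ≠ 0) :
    Integrable fun t : ℝ => (m : ℂ) ^ (-(1 / 2 + t * I)) * conj ((n : ℂ) ^ (-(1 / 2 + t * I))) /
        ((1 / 4 + t ^ 2 : ℝ) : ℂ) := by
  rw [pairing_integrand_eq m n hm hn]
  exact (integrable_cexp_mul_I_div _).const_mul _

/-- **The pairing kernel of the critical-line measure**: for `m, n ≥ 1`,
`∫ m^{-(1/2+it)} · conj(n^{-(1/2+it)}) dt/(1/4+t²) = 2π / max(m,n)` — the Gram matrix of the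
Dirichlet characters `n^{-s}` in `L²(dt/(1/4+t²))` is that of the nested intervals `(0, 1/n]`.
[folklore] -/
theorem integral_cpow_mul_conj_cpow_div (m n : ℕ) (hm : m ≠ 0) (hn : n ≠ 0) :
    ∫ t : ℝ, (m : ℂ) ^ (-(1 / 2 + t * I)) * conj ((n : ℂ) ^ (-(1 / 2 + t * I))) /
        ((1 / 4 + t ^ 2 : ℝ) : ℂ) = ((2 * π / ((max m n : ℕ) : ℝ) : ℝ) : ℂ) := by
  rw [pairing_integrand_eq m n hm hn, integral_const_mul, integral_cexp_mul_I_div,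
    ← Complex.ofReal_mul, exp_mul_two_pi_mul_exp_eq m n hm hn]

/-- Pointwise: `‖Σ_m c_m m^{-s}‖² / (1/4+t²)` is the real part of the double sum of pairing
integrands. [folklore] -/
theorem norm_sq_sum_cpow_div_eq_re (S : Finset ℕ) (c : ℕ → ℂ) (t : ℝ) :
    ‖∑ m ∈ S, c m * (m : ℂ) ^ (-(1 / 2 + t * I))‖ ^ 2 / (1 / 4 + t ^ 2)
      = (∑ m ∈ S, ∑ n ∈ S, c m * conj (c n) *
          ((m : ℂ) ^ (-(1 / 2 + t * I)) * conj ((n : ℂ) ^ (-(1 / 2 + t * I))) /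
            ((1 / 4 + t ^ 2 : ℝ) : ℂ))).re := by
  set F := ∑ m ∈ S, c m * (m : ℂ) ^ (-(1 / 2 + t * I)) with hF
  have h1 : (‖F‖ ^ 2 : ℝ) = (F * conj F).re := by
    rw [Complex.mul_conj, Complex.ofReal_re, Complex.normSq_eq_norm_sq]
  have h2 : F * conj F = ∑ m ∈ S, ∑ n ∈ S, c m * conj (c n) *
      ((m : ℂ) ^ (-(1 / 2 + t * I)) * conj ((n : ℂ) ^ (-(1 / 2 + t * I)))) := by
    rw [hF, map_sum, Finset.sum_mul_sum]
    refine Finset.sum_congr rfl fun m _ => Finset.sum_congr rfl fun n _ => ?_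
    rw [map_mul]
    ring
  rw [h1, ← Complex.div_ofReal_re, h2, Finset.sum_div]
  congr 1
  refine Finset.sum_congr rfl fun m _ => ?_
  rw [Finset.sum_div]
  refine Finset.sum_congr rfl fun n _ => ?_
  ring

/-- **Gram expansion**: for a finite set `S` of positive integers and coefficients `c`,
`∫ ‖Σ_{m∈S} c_m m^{-(1/2+it)}‖² dt/(1/4+t²) = Σ_{m,n∈S} Re(c_m c̄_n) · 2π/max(m,n)`. [folklore] -/
theorem integral_norm_sq_sum_cpow_div (S : Finset ℕ) (hS : ∀ m ∈ S, m ≠ 0) (c : ℕ → ℂ) :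
    ∫ t : ℝ, ‖∑ m ∈ S, c m * (m : ℂ) ^ (-(1 / 2 + t * I))‖ ^ 2 / (1 / 4 + t ^ 2)
      = ∑ m ∈ S, ∑ n ∈ S, (c m * conj (c n)).re * (2 * π / ((max m n : ℕ) : ℝ)) := by
  have hint : ∀ m ∈ S, ∀ n ∈ S, Integrable (fun t : ℝ => c m * conj (c n) *
      ((m : ℂ) ^ (-(1 / 2 + t * I)) * conj ((n : ℂ) ^ (-(1 / 2 + t * I))) /
        ((1 / 4 + t ^ 2 : ℝ) : ℂ))) :=
    fun m hm n hn => (integrable_pairing m n (hS m hm) (hS n hn)).const_mul _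
  have hG : Integrable (fun t : ℝ => ∑ m ∈ S, ∑ n ∈ S, c m * conj (c n) *
      ((m : ℂ) ^ (-(1 / 2 + t * I)) * conj ((n : ℂ) ^ (-(1 / 2 + t * I))) /
        ((1 / 4 + t ^ 2 : ℝ) : ℂ))) :=
    integrable_finsetSum _ fun m hm => integrable_finsetSum _ fun n hn => hint m hm n hn
  simp_rw [norm_sq_sum_cpow_div_eq_re]
  have hre := integral_re hG
  simp only [RCLike.re_to_complex] at hre
  rw [hre, integral_finsetSum _ (fun m hm => integrable_finsetSum _ fun n hn => hint m hm n hn),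
    Complex.re_sum]
  refine Finset.sum_congr rfl fun m hm => ?_
  rw [integral_finsetSum _ (fun n hn => hint m hm n hn), Complex.re_sum]
  refine Finset.sum_congr rfl fun n hn => ?_
  rw [integral_const_mul, integral_cpow_mul_conj_cpow_div m n (hS m hm) (hS n hn),
    Complex.re_mul_ofReal]

/-- The Gram integrand `‖Σ_{m∈S} c_m m^{-(1/2+it)}‖² / (1/4+t²)` is integrable. [folklore] -/
theorem integrable_norm_sq_sum_cpow_div (S : Finset ℕ) (hS : ∀ m ∈ S, m ≠ 0) (c : ℕ → ℂ) :
    Integrable fun t : ℝ => ‖∑ m ∈ S, c m * (m : ℂ) ^ (-(1 / 2 + t * I))‖ ^ 2 / (1 / 4 + t ^ 2) := by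
  have hG : Integrable (fun t : ℝ => ∑ m ∈ S, ∑ n ∈ S, c m * conj (c n) *
      ((m : ℂ) ^ (-(1 / 2 + t * I)) * conj ((n : ℂ) ^ (-(1 / 2 + t * I))) /
        ((1 / 4 + t ^ 2 : ℝ) : ℂ))) :=
    integrable_finsetSum _ fun m hm => integrable_finsetSum _ fun n hn =>
      (integrable_pairing m n (hS m hm) (hS n hn)).const_mul _
  refine hG.re.congr (Eventually.of_forall fun t => ?_)
  simp only [RCLike.re_to_complex]
  exact (norm_sq_sum_cpow_div_eq_re S c t).symm

end Summit.RiemannHypothesis.RiemannHypothesis.Theorems.NbSectionTwo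

end
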